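import Mathlib.Data.ZMod.Basic
import Mathlib.Tactic
import HarnessLib

/-!
# Sums of four cubes: Dem'yanenko's theorem (Cohen, Thm. 6.4.28), and Props. 6.4.25, 6.4.27

H. Cohen, *Number Theory I* (GTM 239) [Cohen2007NumberTheoryI], §6.4.6 ("Sums of Two or More
Cubes"):

* **Prop. 6.4.25** — every rational number is a sum of three cubes of rational numbers (an explicit
  identity with `m = n/9`);
* **Prop. 6.4.27** — every integer is a sum of five cubes of integers, two of them equal
  (`6x = (x−1)³ + (−x)³ + (−x)³ + (x+1)³` and `6 ∣ n − n³`);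
* **Thm. 6.4.28 (Dem'yanenko, 1966)** — every integer `n ≢ ±4 (mod 9)` is a sum of four cubes of
  integers.

Everything here is a `theorem`; the proof of Thm. 6.4.28 is the printed one ("translated essentially
verbatim from Dem'yanenko's paper", with Watkins' prime `p = 83`): the polynomial identities for `6x`,
`6x + 3`, `18x + 1, 7, 8` (and their complements `x ↦ −x`), `54x + 2`, `54x + 20`, `216x − 16`,
`216x + 92`, `83(108x + 46)`, and for the remaining integers (`n ≡ 2 (mod 18)`, `83 ∤ n`, up to sign)
the Pell family `w, x, y, z` linear in `m, a, b` with
`w³ + x³ + y³ + z³ = 18·83·(a² − 3420b²)m + P(a,b)`, `a + b√3420 = (−ε)η^j`, `ε = 3041 + 52√3420`,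
`η = −ε³`: `P ≡ 2 (mod 18)` along the sequence and `P ≡ 71·50^j (mod 83)` runs over all non-zero
residues (`50` is a primitive root mod `83`). The two finite facts are checked by `decide` on the
sequence reduced mod `18` (period `3`) and mod `83` (`j < 82`). One misprint is corrected: in the
identity for `216x − 16` the last cube is `(3x + 3)³` (printed `(3x − 3)²`).

Mathlib/tree search: `lean search 'four cubes|sum_four_cubes|Demjanenko|Dem.yanenko'` — nothing
(Mathlib has Lagrange's four squares, `Nat.sum_four_squares`).
-/

namespace Literature.NumberTheory.DiophantineGeometry

namespace FourCubes

/-! ## Prop. 6.4.25 and Prop. 6.4.27 -/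

/-- **Cohen, Prop. 6.4.25.** Every rational number `n` is a sum of three cubes of rational numbers:
`n = x³ + y³ + z³` with `x = m − 1`, `y = 3(m² + m)/(m² + m + 1)`, `z = (−m³ + 3m + 1)/(m² + m + 1)`,
`m = n/9` ("Proof. Just check."). [cite: Cohen2007NumberTheoryI, Prop. 6.4.25] -/
theorem cohen_prop_6_4_25 (n : ℚ) : ∃ x y z : ℚ, x ^ 3 + y ^ 3 + z ^ 3 = n := by
  have key : ∀ m : ℚ, (m - 1) ^ 3 + (3 * (m ^ 2 + m) / (m ^ 2 + m + 1)) ^ 3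
      + ((-m ^ 3 + 3 * m + 1) / (m ^ 2 + m + 1)) ^ 3 = 9 * m := by
    intro m
    have hd : m ^ 2 + m + 1 ≠ 0 := by nlinarith [sq_nonneg (m + 1 / 2)]
    have hd3 : (m ^ 2 + m + 1) ^ 3 ≠ 0 := pow_ne_zero 3 hd
    have key : ((m - 1) ^ 3 + (3 * (m ^ 2 + m) / (m ^ 2 + m + 1)) ^ 3
        + ((-m ^ 3 + 3 * m + 1) / (m ^ 2 + m + 1)) ^ 3 - 9 * m) * (m ^ 2 + m + 1) ^ 3 = 0 := by
      rw [div_pow, div_pow, sub_mul, add_mul, add_mul, div_mul_cancel₀ _ hd3, div_mul_cancel₀ _ hd3]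
      ring
    rcases mul_eq_zero.mp key with h | h
    · linarith
    · exact absurd h hd3
  exact ⟨_, _, _, by rw [key (n / 9)]; ring⟩

/-- **Cohen, Prop. 6.4.27.** Every integer is a sum of five cubes of integers of which two are equal:
`n = 2x³ + y³ + z³ + t³` (from `6x = (x−1)³ + (−x)³ + (−x)³ + (x+1)³` and `6 ∣ n − n³`).
[cite: Cohen2007NumberTheoryI, Prop. 6.4.27] -/
theorem cohen_prop_6_4_27 (n : ℤ) : ∃ x y z t : ℤ, 2 * x ^ 3 + y ^ 3 + z ^ 3 + t ^ 3 = n := by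
  obtain ⟨m, hm⟩ : (6 : ℤ) ∣ n - n ^ 3 := by
    refine (ZMod.intCast_zmod_eq_zero_iff_dvd _ 6).mp ?_
    push_cast
    generalize (n : ZMod 6) = x
    revert x
    decide
  refine ⟨-m, n, m - 1, m + 1, ?_⟩
  linear_combination -hm

/-! ## The polynomial identities of Thm. 6.4.28 -/

/-- If `n` is a sum of four cubes then so is `−n`. [folklore] -/
private theorem neg_of {n : ℤ} (h : ∃ a b c d : ℤ, a ^ 3 + b ^ 3 + c ^ 3 + d ^ 3 = n) :
    ∃ a b c d : ℤ, a ^ 3 + b ^ 3 + c ^ 3 + d ^ 3 = -n := by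
  obtain ⟨a, b, c, d, h⟩ := h
  exact ⟨-a, -b, -c, -d, by linear_combination -h⟩

/-- `6k` and `6k + 3` (every multiple of `3`). [cite: Cohen2007NumberTheoryI, Thm. 6.4.28 (proof)] -/
theorem of_three_dvd {n : ℤ} (h : (3 : ℤ) ∣ n) :
    ∃ a b c d : ℤ, a ^ 3 + b ^ 3 + c ^ 3 + d ^ 3 = n := by
  have h6 : n % 6 = 0 ∨ n % 6 = 3 := by omega
  rcases h6 with h6 | h6
  · obtain ⟨k, hk⟩ : ∃ k, n = 6 * k := ⟨n / 6, by omega⟩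
    exact ⟨k - 1, -k, -k, k + 1, by rw [hk]; ring⟩
  · obtain ⟨k, hk⟩ : ∃ k, n = 6 * k + 3 := ⟨n / 6, by omega⟩
    exact ⟨k, -k + 4, 2 * k - 5, -2 * k + 4, by rw [hk]; ring⟩

/-- `18k + 1`, `18k + 7`, `18k + 8`. [cite: Cohen2007NumberTheoryI, Thm. 6.4.28 (proof)] -/
theorem of_mod18_1_7_8 {n : ℤ} (h : n % 18 = 1 ∨ n % 18 = 7 ∨ n % 18 = 8) :
    ∃ a b c d : ℤ, a ^ 3 + b ^ 3 + c ^ 3 + d ^ 3 = n := by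
  rcases h with h | h | h
  · obtain ⟨k, hk⟩ : ∃ k, n = 18 * k + 1 := ⟨n / 18, by omega⟩
    exact ⟨2 * k + 14, -2 * k - 23, -3 * k - 26, 3 * k + 30, by rw [hk]; ring⟩
  · obtain ⟨k, hk⟩ : ∃ k, n = 18 * k + 7 := ⟨n / 18, by omega⟩
    exact ⟨k + 2, 6 * k - 1, 8 * k - 2, -9 * k + 2, by rw [hk]; ring⟩
  · obtain ⟨k, hk⟩ : ∃ k, n = 18 * k + 8 := ⟨n / 18, by omega⟩
    exact ⟨k - 5, -k + 14, -3 * k + 29, 3 * k - 30, by rw [hk]; ring⟩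

/-- `n ≡ 2 (mod 18)` and `83 ∣ n`: the identities for `54x + 2`, `54x + 20`, `216x − 16`,
`216x + 92` and `83(108x + 46)`. [cite: Cohen2007NumberTheoryI, Thm. 6.4.28 (proof)] -/
theorem of_mod18_2_of_dvd {n : ℤ} (h : n % 18 = 2) (h83 : (83 : ℤ) ∣ n) :
    ∃ a b c d : ℤ, a ^ 3 + b ^ 3 + c ^ 3 + d ^ 3 = n := by
  have h54 : n % 54 = 2 ∨ n % 54 = 20 ∨ n % 54 = 38 := by clear h83; omega
  rcases h54 with h54 | h54 | h54
  · obtain ⟨k, hk⟩ : ∃ k, n = 54 * k + 2 := ⟨n / 54, by clear h83; omega⟩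
    exact ⟨29484 * k ^ 2 + 2211 * k + 43, -29484 * k ^ 2 - 2157 * k - 41, 9828 * k ^ 2 + 485 * k + 4,
      -9828 * k ^ 2 - 971 * k - 22, by rw [hk]; ring⟩
  · obtain ⟨k, hk⟩ : ∃ k, n = 54 * k + 20 := ⟨n / 54, by clear h83; omega⟩
    exact ⟨3 * k - 11, -3 * k + 10, k + 2, -k + 7, by rw [hk]; ring⟩
  · have h108 : n % 108 = 38 ∨ n % 108 = 92 := by clear h83; omega
    rcases h108 with h108 | h108
    · -- `83 ∣ n`, `n ≡ 38 (mod 108)`: `n = 83(108k + 46)`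
      obtain ⟨n', hn'⟩ := h83
      obtain ⟨k, hk⟩ : ∃ k, n' = 108 * k + 46 := ⟨n' / 108, by omega⟩
      refine ⟨29484 * k ^ 2 + 25143 * k + 5371, -29484 * k ^ 2 - 25089 * k - 5348,
        9828 * k ^ 2 + 8129 * k + 1682, -9828 * k ^ 2 - 8615 * k - 1889, ?_⟩
      rw [hn', hk]; ring
    · have h216 : n % 216 = 92 ∨ n % 216 = 200 := by clear h83; omega
      rcases h216 with h216 | h216
      · obtain ⟨k, hk⟩ : ∃ k, n = 216 * k + 92 := ⟨n / 216, by clear h83; omega⟩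
        exact ⟨3 * k - 164, -3 * k + 160, k - 35, -k + 71, by rw [hk]; ring⟩
      · obtain ⟨k, hk⟩ : ∃ k, n = 216 * k - 16 := ⟨n / 216 + 1, by clear h83; omega⟩
        exact ⟨-27 * k + 13, 24 * k - 12, 18 * k - 8, 3 * k + 3, by rw [hk]; ring⟩

/-! ## The Pell family (`p = 83`) -/

/-- One step `a + b√3420 ↦ (a + b√3420)·η`, `η = −ε³ = −112488782561 − 1923517596√3420`,
over any commutative ring (so that it can be reduced mod `18` and mod `83`).
[cite: Cohen2007NumberTheoryI, Thm. 6.4.28 (proof)] -/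
def step {R : Type*} [CommRing R] (p : R × R) : R × R :=
  (p.1 * (-112488782561) + 3420 * p.2 * (-1923517596), p.1 * (-1923517596) + p.2 * (-112488782561))

/-- The sequence `a_j + b_j√3420 = (−ε)·η^j`, `ε = 3041 + 52√3420`. [cite: Cohen2007NumberTheoryI, Thm. 6.4.28 (proof)] -/
def pellSeq {R : Type*} [CommRing R] : ℕ → R × R
  | 0 => (-3041, -52)
  | j + 1 => step (pellSeq j)

/-- `P(a, b) = (25a − 2937b)³ + (−19a + 2746b)³ + (−9a − 602b)³ + (27a − 928b)³`.
[cite: Cohen2007NumberTheoryI, Thm. 6.4.28 (proof)] -/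
def P {R : Type*} [CommRing R] (p : R × R) : R :=
  (25 * p.1 - 2937 * p.2) ^ 3 + (-19 * p.1 + 2746 * p.2) ^ 3 + (-9 * p.1 - 602 * p.2) ^ 3
    + (27 * p.1 - 928 * p.2) ^ 3

/-- Unfolding lemma. [cite: Cohen2007NumberTheoryI, Thm. 6.4.28 (proof)] -/
theorem pellSeq_succ {R : Type*} [CommRing R] (j : ℕ) :
    pellSeq (R := R) (j + 1) = step (pellSeq (R := R) j) := rfl

/-- `η` has norm `1`, so `step` preserves `a² − 3420b²`. [cite: Cohen2007NumberTheoryI, Thm. 6.4.28 (proof)] -/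
theorem step_norm (q : ℤ × ℤ) : (step q).1 ^ 2 - 3420 * (step q).2 ^ 2 = q.1 ^ 2 - 3420 * q.2 ^ 2 := by
  simp only [step]
  ring

/-- The Pell equation `a² − 3420 b² = 1` holds along the sequence. [cite: Cohen2007NumberTheoryI, Thm. 6.4.28 (proof)] -/
theorem pellSeq_norm (j : ℕ) : (pellSeq (R := ℤ) j).1 ^ 2 - 3420 * (pellSeq (R := ℤ) j).2 ^ 2 = 1 := by
  induction j with
  | zero => rfl
  | succ j ih => rw [pellSeq_succ, step_norm, ih]

/-- "We check that `w³ + x³ + y³ + z³ = 18p(a² − 3420b²)m + P(a, b)`" with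
`w = −(24m − 25a + 2937b)`, `x = 27m − 19a + 2746b`, `y = −(19m + 9a + 602b)`,
`z = 10m + 27a − 928b`, `p = 83`. [cite: Cohen2007NumberTheoryI, Thm. 6.4.28 (proof)] -/
theorem pell_identity (a b m : ℤ) :
    (-(24 * m - 25 * a + 2937 * b)) ^ 3 + (27 * m - 19 * a + 2746 * b) ^ 3
      + (-(19 * m + 9 * a + 602 * b)) ^ 3 + (10 * m + 27 * a - 928 * b) ^ 3
      = 18 * 83 * (a ^ 2 - 3420 * b ^ 2) * m + P (a, b) := by
  simp only [P]; ring

/-- `step` commutes with reduction modulo `N`. [cite: Cohen2007NumberTheoryI, Thm. 6.4.28 (proof)] -/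
theorem step_cast (N : ℕ) (q : ℤ × ℤ) :
    (((step q).1 : ℤ) : ZMod N) = (step ((q.1 : ZMod N), (q.2 : ZMod N))).1 ∧
      (((step q).2 : ℤ) : ZMod N) = (step ((q.1 : ZMod N), (q.2 : ZMod N))).2 := by
  simp only [step]
  push_cast
  exact ⟨rfl, rfl⟩

/-- Reduction of the sequence modulo `N`. [cite: Cohen2007NumberTheoryI, Thm. 6.4.28 (proof)] -/
theorem pellSeq_cast (N : ℕ) (j : ℕ) :
    (((pellSeq (R := ℤ) j).1 : ℤ) : ZMod N) = (pellSeq (R := ZMod N) j).1 ∧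
      (((pellSeq (R := ℤ) j).2 : ℤ) : ZMod N) = (pellSeq (R := ZMod N) j).2 := by
  induction j with
  | zero => simp [pellSeq]
  | succ j ih =>
    obtain ⟨h1, h2⟩ := ih
    rw [pellSeq_succ, pellSeq_succ, (step_cast N _).1, (step_cast N _).2, h1, h2]
    exact ⟨rfl, rfl⟩

/-- `P` commutes with reduction modulo `N`. [cite: Cohen2007NumberTheoryI, Thm. 6.4.28 (proof)] -/
theorem P_cast (N : ℕ) (j : ℕ) :
    ((P (pellSeq (R := ℤ) j) : ℤ) : ZMod N) = P (pellSeq (R := ZMod N) j) := by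
  obtain ⟨h1, h2⟩ := pellSeq_cast N j
  simp only [P]
  push_cast
  rw [h1, h2]

/-- "`50` is a primitive root modulo `p = 83`" in the form used: `P(a_j, b_j) (≡ 71·50^j)` runs over
all non-zero residues mod `83` for `j < 82`. [cite: Cohen2007NumberTheoryI, Thm. 6.4.28 (proof)] -/
theorem cover_mod_83 : ∀ r : ZMod 83, r ≠ 0 → ∃ j : Fin 82, P (pellSeq (R := ZMod 83) j) = r := by
  set_option maxRecDepth 100000 in decide

/-- The sequence mod `18` has period `3`. [cite: Cohen2007NumberTheoryI, Thm. 6.4.28 (proof)] -/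
theorem pellSeq_mod18_period (j : ℕ) : pellSeq (R := ZMod 18) (j + 3) = pellSeq (R := ZMod 18) j := by
  induction j with
  | zero => set_option maxRecDepth 100000 in decide
  | succ j ih =>
    show step (pellSeq (R := ZMod 18) (j + 3)) = step (pellSeq (R := ZMod 18) j)
    rw [ih]

/-- "the condition modulo 18": `P(a_j, b_j) ≡ 2 (mod 18)` for every `j`.
[cite: Cohen2007NumberTheoryI, Thm. 6.4.28 (proof)] -/
theorem P_mod_18 (j : ℕ) : P (pellSeq (R := ZMod 18) j) = 2 := by
  induction j using Nat.strong_induction_on with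
  | _ j ih =>
    rcases Nat.lt_or_ge j 3 with hlt | hge
    · interval_cases j <;> set_option maxRecDepth 100000 in decide
    · obtain ⟨i, rfl⟩ : ∃ i, j = i + 3 := ⟨j - 3, by omega⟩
      rw [pellSeq_mod18_period]
      exact ih i (by omega)

/-- `n ≡ 2 (mod 18)`, `83 ∤ n`: the Pell family. [cite: Cohen2007NumberTheoryI, Thm. 6.4.28 (proof)] -/
theorem of_mod18_2_of_not_dvd {n : ℤ} (h : n % 18 = 2) (h83 : ¬ (83 : ℤ) ∣ n) :
    ∃ a b c d : ℤ, a ^ 3 + b ^ 3 + c ^ 3 + d ^ 3 = n := by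
  have hr : (n : ZMod 83) ≠ 0 := by
    rw [Ne, ZMod.intCast_zmod_eq_zero_iff_dvd]
    exact_mod_cast h83
  obtain ⟨j, hj⟩ := cover_mod_83 _ hr
  have h1 : (83 : ℤ) ∣ n - P (pellSeq (R := ℤ) j) := by
    have e : ((P (pellSeq (R := ℤ) j) : ℤ) : ZMod 83) = ((n : ℤ) : ZMod 83) := by
      rw [P_cast 83 j, hj]
    exact (ZMod.intCast_eq_intCast_iff_dvd_sub _ _ 83).mp e
  have h2 : (18 : ℤ) ∣ n - P (pellSeq (R := ℤ) j) := by
    have e : ((P (pellSeq (R := ℤ) j) : ℤ) : ZMod 18) = ((n : ℤ) : ZMod 18) := by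
      rw [P_cast 18 j, P_mod_18]
      have : ((2 : ℤ) : ZMod 18) = ((n : ℤ) : ZMod 18) := by
        rw [ZMod.intCast_eq_intCast_iff_dvd_sub]
        push_cast
        clear h83 hr hj h1
        omega
      exact_mod_cast this
    exact (ZMod.intCast_eq_intCast_iff_dvd_sub _ _ 18).mp e
  obtain ⟨m, hm⟩ : (1494 : ℤ) ∣ n - P (pellSeq (R := ℤ) j) := by
    have h3 : IsCoprime (83 : ℤ) 18 := by norm_num [Int.isCoprime_iff_gcd_eq_one]
    simpa using h3.mul_dvd h1 h2
  refine ⟨-(24 * m - 25 * (pellSeq (R := ℤ) j).1 + 2937 * (pellSeq (R := ℤ) j).2),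
    27 * m - 19 * (pellSeq (R := ℤ) j).1 + 2746 * (pellSeq (R := ℤ) j).2,
    -(19 * m + 9 * (pellSeq (R := ℤ) j).1 + 602 * (pellSeq (R := ℤ) j).2),
    10 * m + 27 * (pellSeq (R := ℤ) j).1 - 928 * (pellSeq (R := ℤ) j).2, ?_⟩
  rw [pell_identity, pellSeq_norm, Prod.mk.eta]
  linear_combination -hm

/-! ## Thm. 6.4.28 -/

/-- **Cohen, Thm. 6.4.28 (Dem'yanenko 1966).** Every integer `n ≢ ±4 (mod 9)` is a sum of four
cubes of integers. [cite: Cohen2007NumberTheoryI, Thm. 6.4.28] -/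
theorem demyanenko (n : ℤ) (h4 : n % 9 ≠ 4) (h5 : n % 9 ≠ 5) :
    ∃ a b c d : ℤ, a ^ 3 + b ^ 3 + c ^ 3 + d ^ 3 = n := by
  by_cases h3 : (3 : ℤ) ∣ n
  · exact of_three_dvd h3
  have hcases : n % 18 = 1 ∨ n % 18 = 7 ∨ n % 18 = 8 ∨ n % 18 = 17 ∨ n % 18 = 11 ∨ n % 18 = 10 ∨
      n % 18 = 2 ∨ n % 18 = 16 := by omega
  rcases hcases with h | h | h | h | h | h | h | h
  · exact of_mod18_1_7_8 (Or.inl h)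
  · exact of_mod18_1_7_8 (Or.inr (Or.inl h))
  · exact of_mod18_1_7_8 (Or.inr (Or.inr h))
  · have := of_mod18_1_7_8 (n := -n) (Or.inl (by omega))
    simpa using neg_of this
  · have := of_mod18_1_7_8 (n := -n) (Or.inr (Or.inl (by omega)))
    simpa using neg_of this
  · have := of_mod18_1_7_8 (n := -n) (Or.inr (Or.inr (by omega)))
    simpa using neg_of this
  · by_cases h83 : (83 : ℤ) ∣ n
    · exact of_mod18_2_of_dvd h h83
    · exact of_mod18_2_of_not_dvd h h83
  · have h' : (-n) % 18 = 2 := by omega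
    by_cases h83 : (83 : ℤ) ∣ n
    · have := of_mod18_2_of_dvd h' (dvd_neg.mpr h83)
      simpa using neg_of this
    · have := of_mod18_2_of_not_dvd h' (by rwa [dvd_neg])
      simpa using neg_of this

end FourCubes

end Literature.NumberTheory.DiophantineGeometry
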